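import Summits.QuantumFields.BalabanUV.Beta.D1BFx.CoframeJetProjection
import Summits.QuantumFields.BalabanUV.Beta.D1BFx.GhostStencilWard

/-!
# `BalabanUV.Beta.D1BFx.CoframeJetDipole` — road «BF-x» for BINDER row D1, slot (K), binder (C1) «TB4-W CO-FRAME FIRST JET,
# m-UNIFORM MASS»: THE DIPOLE FORM OF THE PROJECTOR SANDWICH AND THE REDUCTION OF (C1) TO FIRST-GRADIENT MASS LETTERS

HONEST DEPENDENCY (page 1, mandatory): continuum YM on T⁴ ⇐ BetaPertH ∧ nine spine estimates (0/9 proved); BetaPertH ⇐ (D1) ∧ (D4) ∧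
CAP+tail; G-an2-4 gates asym, D1 and NE2/3/4.  HONEST FRAMING (cell contract, verbatim): «discharging `BetaPertH` makes Bałaban's UV
stability UNCONDITIONAL — a real constructive-QFT result; it is NOT the continuum limit and NOT the Clay problem.»  THIS FILE DISCHARGES
NOTHING of D1 / BetaPertH: [folklore] finite-support algebra and weighted `ℓ¹(ℤ⁴ × ℤ⁴)` bookkeeping over the road's OWN typed objects
(`ghCur`, `dSw`, `jetR`, `jetC`, `tBw₁`, `Pgt`, `Rgt`, `Ggh`).  It proves NO estimate of Bałaban's, NO mass letter of any leg, and it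
does NOT close (C1): it REDUCES the displayed (C1) row of PART 14 (`RoadEndBFxRoadScalesS.d1Rep_BFx_road_scales_sbpS`, binders
`hTs hTm`) at one scale `n` to six FIRST-GRADIENT weighted mass letters of `Pgt n a`, `Ggh n a ∘ Rgt n a`, `Rgt n a ∘ Ggh n a`, `Rgt n a`
(gan24-leaf-05's (γ)∕δ′ currency supplies them on `n = L^k`).  0∕4 row-D1 binders discharged; (K) NOT closed; NOT D1, NOT BetaPertH,
NOT continuum, NOT Clay.

WHAT IS HERE (unit `b2b-balaban-beta-d1-formalise-leaf-03`, gen 25; the lineage is OWNER OF RECORD of the (C1)(C2) OBJECTS, ruling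
ρ-g19-1 amended, CLAIMS.log l.43347; this file = INTENT-1 «COFRAME-JET-DIPOLE» l.44044):
* §1 THE DIPOLE READ-OUTS (no summability — `ghCur κ u` has two-point support): for ANY site kernels `A B : MKer 4 Unit`,
  `((A ∘ ghCur κ u) ∘ B)(x,z) = (A ∘ (ghCur κ u ∘ B))(x,z) = A(x,u+e_κ)·B(u,z) − A(x,u)·B(u+e_κ,z)`.
* §2 `dSw` OF A DIPOLE FACTORISES: `dSw(A∘ghCur κ u∘B)(x,z,α,β) = [A(x+e_α,u+e_κ) − A(x,u+e_κ)]·[B(u,z+e_β) − B(u,z)]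
  − [A(x+e_α,u) − A(x,u)]·[B(u+e_κ,z+e_β) − B(u+e_κ,z)]` — ONE lattice gradient on EACH factor (the x-difference of `dSw` lands on
  `A`'s row index, its z-difference on `B`'s column index); the fibre sum of absolute values is bounded by the two outer products.
* §3 [folklore] weighted `ℓ¹(Site × Site)` toolkit: comparison, outer products (`Summable.mul_of_nonneg`, `Summable.tsum_mul_tsum`),
  recentring of the `u`-centred growth weight `e^{s|x−u|₁} ≤ e^{s|y−u|₁}·e^{s|x−y|₁}`.
* §4 the fibre sums of `jetR κ u Y` ∕ `jetC κ u Y` (one pinned row ∕ column).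
* THE SEQUEL `CoframeJetDipoleMass` (same INTENT) carries §5 (weighted masses of one `dSw`-dipole ∕ one pinned word ∕ the combination
  rule) and §6 (the (C1) reduction `tBw₁_weighted_mass_le(_of_col)`: PART 14's `hTs hTm` summand at scale `n` ⇐ first-gradient letters of
  `Pgt`, `Rgt∘Ggh`, `Rgt`, the `n²` of the legs against TWO gradient gains, one per factor).

References: the road's END `RoadEndBFxRoadScalesS` (OWNER d1-p2 g19, INTENT-7 l.43964); façade `PackedRoadRowsPow.jet_letters_pow`
(leaf-01 g24); currency `KernelMassCalculus` ∕ `ProjectorMasses` ∕ `GhostLegProfile` (gan24-leaf-05 g54, INTENT-4 l.43935).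
No `def`, no `def … : Prop`, nothing cited as mathematics; [Balaban1987RG1] §4 is BACKGROUND for why these words exist, not a source
of any statement below.
-/

noncomputable section

namespace Summit.QuantumFields.BalabanUV.Beta.D1BFx.CoframeJetDipole

open Literature.MathematicalPhysics.QuantumFieldTheory.Balaban1983to89
open Literature.MathematicalPhysics.QuantumFieldTheory.Balaban1983to89.Beta
open B12Sec2to5 (l1 l1_nonneg)
open ExpKernelCalculus (Site MKer comp l1_sub_triangle l1_sub_symm)
open AffineAveraging (unitVec)
open KernelReflection (comp_smul_right)
open Summit.QuantumFields.BalabanUV.Beta.TameKernelCalculus (trK trK_apply trK_comp)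
open Summit.QuantumFields.BalabanUV.Beta.D1BFx.GhostStencil (ghCur ghCur_apply l1_unitVec l1_zero)
open Summit.QuantumFields.BalabanUV.Beta.D1BFx.GhostStencilReflection (add_unitVec_ne_self)
open Summit.QuantumFields.BalabanUV.Beta.D1BFx.GhostStencilWard (comp_unit_apply comp_ghCur_apply ghCur_comp_apply)
open Summit.QuantumFields.BalabanUV.Beta.D1BFx.GhostLeg (Ggh trK_Ggh)
open Summit.QuantumFields.BalabanUV.Beta.D1BFx.RProjector (Pgt)
open Summit.QuantumFields.BalabanUV.Beta.D1BFx.RJetProjector (Rgt)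
open Summit.QuantumFields.BalabanUV.Beta.D1BFx.RProjectorJetLeibniz (trK_Pgt)
open Summit.QuantumFields.BalabanUV.Beta.D1BFx.TorusWeightWordTwisted (tBw₁)
open Summit.QuantumFields.BalabanUV.Beta.D1BFx.TorusJetSandwichArrays (jetR jetC jetR_apply jetC_apply)
open Summit.QuantumFields.BalabanUV.Beta.D1BFx.RJetAssembly (dSw dSw_apply)
open Summit.QuantumFields.BalabanUV.Beta.D1BFx.GluonNeedleSplit (dSw_add dSw_smul)
open Summit.QuantumFields.BalabanUV.Beta.D1BFx.CoframeJetProjection (tBw₁_eq_projection wL_eq wR_eq trK_Rgt)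


variable (κ : Fin 4) (u : Site 4)

/-! ## §1 The dipole read-outs of the current sandwich -/

/-- [folklore] **`(A ∘ ghCur κ u) ∘ B` IS A DIPOLE**: `((A∘ghCur κ u)∘B)(x,z) = A(x,u+e_κ)·B(u,z) − A(x,u)·B(u+e_κ,z)` for ANY site kernels
`A B` (finite support of the current in the middle index; no summability). -/
theorem comp_comp_ghCur_apply (A B : MKer 4 Unit) (x z : Site 4) (v w : Unit) :
    comp (comp A (ghCur κ u)) B x z v w
      = A x (u + unitVec κ) () () * B u z () () - A x u () () * B (u + unitVec κ) z () () := by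
  have hne : u + unitVec κ ≠ u := add_unitVec_ne_self u κ
  rw [comp_unit_apply]
  simp_rw [comp_ghCur_apply]
  rw [tsum_eq_sum (s := ({u + unitVec κ, u} : Finset (Site 4))) (fun y hy => by
      rw [Finset.mem_insert, Finset.mem_singleton, not_or] at hy
      rw [if_neg hy.2, if_neg hy.1, mul_zero, mul_zero, sub_zero, zero_mul]),
    Finset.sum_pair hne]
  simp only [hne, hne.symm, if_true, if_false, mul_one, mul_zero, sub_zero, zero_sub, neg_mul]
  ring

/-- [folklore] **`A ∘ (ghCur κ u ∘ B)` IS THE SAME DIPOLE**: `(A∘(ghCur κ u∘B))(x,z) = A(x,u+e_κ)·B(u,z) − A(x,u)·B(u+e_κ,z)`. -/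
theorem comp_ghCur_comp_apply (A B : MKer 4 Unit) (x z : Site 4) (v w : Unit) :
    comp A (comp (ghCur κ u) B) x z v w
      = A x (u + unitVec κ) () () * B u z () () - A x u () () * B (u + unitVec κ) z () () := by
  have hne : u + unitVec κ ≠ u := add_unitVec_ne_self u κ
  rw [comp_unit_apply]
  simp_rw [ghCur_comp_apply]
  rw [tsum_eq_sum (s := ({u + unitVec κ, u} : Finset (Site 4))) (fun y hy => by
      rw [Finset.mem_insert, Finset.mem_singleton, not_or] at hy
      rw [if_neg hy.1, if_neg hy.2, zero_mul, zero_mul, sub_zero, mul_zero]),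
    Finset.sum_pair hne]
  simp only [hne, hne.symm, if_true, if_false, one_mul, zero_mul, sub_zero, zero_sub, mul_neg]
  ring

/-- [folklore] The dipole as a kernel identity, left parenthesisation. -/
theorem comp_comp_ghCur_eq (A B : MKer 4 Unit) :
    comp (comp A (ghCur κ u)) B = fun x z _ _ => A x (u + unitVec κ) () () * B u z () () - A x u () () * B (u + unitVec κ) z () () := by
  funext x z v w
  exact comp_comp_ghCur_apply κ u A B x z v w

/-- [folklore] The dipole as a kernel identity, right parenthesisation. -/
theorem comp_ghCur_comp_eq (A B : MKer 4 Unit) :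
    comp A (comp (ghCur κ u) B) = fun x z _ _ => A x (u + unitVec κ) () () * B u z () () - A x u () () * B (u + unitVec κ) z () () := by
  funext x z v w
  exact comp_ghCur_comp_apply κ u A B x z v w

/-- [folklore] In particular the two parenthesisations agree (no tameness needed when the middle factor is the current). -/
theorem comp_assoc_ghCur (A B : MKer 4 Unit) : comp (comp A (ghCur κ u)) B = comp A (comp (ghCur κ u) B) := by
  rw [comp_comp_ghCur_eq, comp_ghCur_comp_eq]

/-! ## §2 `dSw` of a dipole factorises: one gradient on each factor -/

/-- [folklore] **`dSw` OF A DIPOLE**: `dSw (x z ↦ A(x,u+e)B(u,z) − A(x,u)B(u+e,z)) (x,z,α,β)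
= [A(x+e_α,u+e) − A(x,u+e)]·[B(u,z+e_β) − B(u,z)] − [A(x+e_α,u) − A(x,u)]·[B(u+e,z+e_β) − B(u+e,z)]`. -/
theorem dSw_dipole (A B : MKer 4 Unit) (x z : Site 4) (α β : Fin 4) :
    dSw (fun x z _ _ => A x (u + unitVec κ) () () * B u z () () - A x u () () * B (u + unitVec κ) z () ()) x z α β
      = (A (x + unitVec α) (u + unitVec κ) () () - A x (u + unitVec κ) () ()) * (B u (z + unitVec β) () () - B u z () ())
        - (A (x + unitVec α) u () () - A x u () ()) * (B (u + unitVec κ) (z + unitVec β) () () - B (u + unitVec κ) z () ()) := by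
  simp only [dSw_apply]
  ring

/-- [folklore] **`dSw ((A∘ghCur κ u)∘B)` FACTORISES** (left parenthesisation). -/
theorem dSw_comp_comp_ghCur (A B : MKer 4 Unit) (x z : Site 4) (α β : Fin 4) :
    dSw (comp (comp A (ghCur κ u)) B) x z α β
      = (A (x + unitVec α) (u + unitVec κ) () () - A x (u + unitVec κ) () ()) * (B u (z + unitVec β) () () - B u z () ())
        - (A (x + unitVec α) u () () - A x u () ()) * (B (u + unitVec κ) (z + unitVec β) () () - B (u + unitVec κ) z () ()) := by
  rw [comp_comp_ghCur_eq]
  exact dSw_dipole κ u A B x z α β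

/-- [folklore] **`dSw (A∘(ghCur κ u∘B))` FACTORISES** (right parenthesisation). -/
theorem dSw_comp_ghCur_comp (A B : MKer 4 Unit) (x z : Site 4) (α β : Fin 4) :
    dSw (comp A (comp (ghCur κ u) B)) x z α β
      = (A (x + unitVec α) (u + unitVec κ) () () - A x (u + unitVec κ) () ()) * (B u (z + unitVec β) () () - B u z () ())
        - (A (x + unitVec α) u () () - A x u () ()) * (B (u + unitVec κ) (z + unitVec β) () () - B (u + unitVec κ) z () ()) := by
  rw [comp_ghCur_comp_eq]
  exact dSw_dipole κ u A B x z α β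

/-- [folklore] **THE FIBRE SUM OF A `dSw`-DIPOLE IS BELOW TWO OUTER PRODUCTS OF GRADIENTS**:
`Σ_{αβ} |dSw(dipole)(x,z,α,β)| ≤ (Σ_α|∇_α A(·,u+e)(x)|)·(Σ_β|∇_β B(u,·)(z)|) + (Σ_α|∇_α A(·,u)(x)|)·(Σ_β|∇_β B(u+e,·)(z)|)`. -/
theorem sum_abs_dSw_dipole_le (A B : MKer 4 Unit) (x z : Site 4) :
    ∑ α, ∑ β, |dSw (fun x z _ _ => A x (u + unitVec κ) () () * B u z () () - A x u () () * B (u + unitVec κ) z () ()) x z α β|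
      ≤ (∑ α, |A (x + unitVec α) (u + unitVec κ) () () - A x (u + unitVec κ) () ()|) * (∑ β, |B u (z + unitVec β) () () - B u z () ()|)
        + (∑ α, |A (x + unitVec α) u () () - A x u () ()|)
          * (∑ β, |B (u + unitVec κ) (z + unitVec β) () () - B (u + unitVec κ) z () ()|) := by
  rw [Finset.sum_mul_sum, Finset.sum_mul_sum, ← Finset.sum_add_distrib]
  refine Finset.sum_le_sum fun α _ => ?_
  rw [← Finset.sum_add_distrib]
  refine Finset.sum_le_sum fun β _ => ?_
  rw [dSw_dipole, ← abs_mul, ← abs_mul]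
  exact abs_sub _ _

/-! ## §3 Weighted `ℓ¹(Site × Site)` toolkit -/

/-- [folklore] COMPARISON: a nonnegative function below a summable one with sum `≤ M` is summable with sum `≤ M`. -/
theorem summable_and_tsum_le_of_le {ι : Type*} {F G : ι → ℝ} {M : ℝ} (h0 : ∀ i, 0 ≤ F i) (hle : ∀ i, F i ≤ G i) (hG : Summable G)
    (hM : ∑' i, G i ≤ M) : Summable F ∧ ∑' i, F i ≤ M :=
  ⟨hG.of_nonneg_of_le h0 hle, ((hG.of_nonneg_of_le h0 hle).tsum_le_tsum hle hG).trans hM⟩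

/-- [folklore] OUTER PRODUCTS: for nonnegative summable `f g` on `Site 4` with sums `≤ Mf`, `≤ Mg`, the function `(p,q) ↦ f p · g q` is
summable on `Site 4 × Site 4` with sum `≤ Mf · Mg`. -/
theorem outer_summable_and_tsum_le {f g : Site 4 → ℝ} {Mf Mg : ℝ} (hf0 : ∀ x, 0 ≤ f x) (hg0 : ∀ x, 0 ≤ g x) (hf : Summable f)
    (hg : Summable g) (hfM : ∑' x, f x ≤ Mf) (hgM : ∑' x, g x ≤ Mg) :
    Summable (fun p : Site 4 × Site 4 => f p.1 * g p.2) ∧ ∑' p : Site 4 × Site 4, f p.1 * g p.2 ≤ Mf * Mg := by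
  have hs : Summable (fun p : Site 4 × Site 4 => f p.1 * g p.2) := hf.mul_of_nonneg hg (fun x => hf0 x) (fun x => hg0 x)
  refine ⟨hs, ?_⟩
  rw [← hf.tsum_mul_tsum hg hs]
  exact mul_le_mul hfM hgM (tsum_nonneg hg0) ((tsum_nonneg hf0).trans hfM)


/-- [folklore] RECENTRING of the growth weight: `e^{s|x−u|₁} ≤ e^{s|y−u|₁}·e^{s|x−y|₁}` (`s ≥ 0`), so a `y`-centred weighted mass
`≤ M` is a `u`-centred weighted mass `≤ e^{s|y−u|₁}·M`. -/
theorem recentre_summable_and_tsum_le {f : Site 4 → ℝ} {s M : ℝ} (hf0 : ∀ x, 0 ≤ f x) (hs : 0 ≤ s) (y u : Site 4)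
    (h : Summable (fun x => f x * Real.exp (s * l1 (x - y))) ∧ ∑' x, f x * Real.exp (s * l1 (x - y)) ≤ M) :
    Summable (fun x => f x * Real.exp (s * l1 (x - u))) ∧
      ∑' x, f x * Real.exp (s * l1 (x - u)) ≤ Real.exp (s * l1 (y - u)) * M := by
  have hle : ∀ x, f x * Real.exp (s * l1 (x - u)) ≤ Real.exp (s * l1 (y - u)) * (f x * Real.exp (s * l1 (x - y))) := fun x => by
    have htri : l1 (x - u) ≤ l1 (x - y) + l1 (y - u) := l1_sub_triangle x y u
    have hexp : Real.exp (s * l1 (x - u)) ≤ Real.exp (s * l1 (y - u)) * Real.exp (s * l1 (x - y)) := by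
      rw [← Real.exp_add, Real.exp_le_exp]
      have := mul_le_mul_of_nonneg_left htri hs
      rw [mul_add] at this
      linarith
    calc f x * Real.exp (s * l1 (x - u)) ≤ f x * (Real.exp (s * l1 (y - u)) * Real.exp (s * l1 (x - y))) :=
          mul_le_mul_of_nonneg_left hexp (hf0 x)
      _ = Real.exp (s * l1 (y - u)) * (f x * Real.exp (s * l1 (x - y))) := by ring
  refine summable_and_tsum_le_of_le (fun x => mul_nonneg (hf0 x) (Real.exp_pos _).le) hle (h.1.mul_left _) ?_
  rw [tsum_mul_left]
  exact mul_le_mul_of_nonneg_left h.2 (Real.exp_pos _).le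

/-- [folklore] The weight at its own centre is `1`. -/
theorem weight_self (s : ℝ) : Real.exp (s * l1 (u - u)) = 1 := by
  rw [sub_self, l1_zero, mul_zero, Real.exp_zero]

/-- [folklore] The weight at a nearest neighbour of its centre is `e^{s}`. -/
theorem weight_neighbour (s : ℝ) : Real.exp (s * l1 (u + unitVec κ - u)) = Real.exp s := by
  rw [add_sub_cancel_left, l1_unitVec, mul_one]

/-- [folklore] RECENTRING at the centre itself (factor `1`). -/
theorem recentre_self {f : Site 4 → ℝ} {s M : ℝ} (hf0 : ∀ x, 0 ≤ f x) (hs : 0 ≤ s)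
    (h : Summable (fun x => f x * Real.exp (s * l1 (x - u))) ∧ ∑' x, f x * Real.exp (s * l1 (x - u)) ≤ M) :
    Summable (fun x => f x * Real.exp (s * l1 (x - u))) ∧ ∑' x, f x * Real.exp (s * l1 (x - u)) ≤ M := by
  have := recentre_summable_and_tsum_le hf0 hs u u h
  rwa [weight_self, one_mul] at this

/-- [folklore] RECENTRING from the neighbour `u + e_κ` to `u` (factor `e^{s}`). -/
theorem recentre_neighbour {f : Site 4 → ℝ} {s M : ℝ} (hf0 : ∀ x, 0 ≤ f x) (hs : 0 ≤ s)
    (h : Summable (fun x => f x * Real.exp (s * l1 (x - (u + unitVec κ)))) ∧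
      ∑' x, f x * Real.exp (s * l1 (x - (u + unitVec κ))) ≤ M) :
    Summable (fun x => f x * Real.exp (s * l1 (x - u))) ∧ ∑' x, f x * Real.exp (s * l1 (x - u)) ≤ Real.exp s * M := by
  have := recentre_summable_and_tsum_le hf0 hs (u + unitVec κ) u h
  rwa [weight_neighbour] at this

/-- [folklore] The indicator of the centre: summable with sum `≤ 1`. -/
theorem ind_summable_and_tsum_le : Summable (fun p : Site 4 => if p = u then (1 : ℝ) else 0) ∧
    ∑' p : Site 4, (if p = u then (1 : ℝ) else 0) ≤ 1 := by
  refine ⟨summable_of_ne_finset_zero (s := ({u} : Finset (Site 4))) (fun p hp => ?_), ?_⟩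
  · rw [Finset.mem_singleton] at hp
    exact if_neg hp
  · rw [tsum_eq_single u (fun p hp => if_neg hp), if_pos rfl]

/-- [folklore] The indicator absorbs the weight at the centre: `[p = u]·e^{s|p−u|₁} = [p = u]`. -/
theorem ind_mul_weight (s : ℝ) (p : Site 4) :
    (if p = u then (1 : ℝ) else 0) * Real.exp (s * l1 (p - u)) = if p = u then (1 : ℝ) else 0 := by
  by_cases hp : p = u
  · rw [if_pos hp, hp, weight_self, one_mul]
  · rw [if_neg hp, zero_mul]

/-! ## §4 The fibre sums of the two pinned `Ḋ`-words -/

/-- [folklore] **FIBRE SUM OF `jetR`**: `Σ_{αβ} |jetR κ u Y p q α β| = [p = u]·Σ_β |Y(u+e_κ, q+e_β) − Y(u+e_κ, q)|` (one pinned row). -/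
theorem sum_abs_jetR (Y : MKer 4 Unit) (p q : Site 4) :
    ∑ α, ∑ β, |jetR κ u Y p q α β|
      = (if p = u then (1 : ℝ) else 0) * ∑ β, |Y (u + unitVec κ) (q + unitVec β) () () - Y (u + unitVec κ) q () ()| := by
  by_cases hp : p = u
  · rw [if_pos hp, one_mul,
      Finset.sum_eq_single κ (fun α _ hα => Finset.sum_eq_zero fun β _ => by
        rw [jetR_apply, if_neg (fun h => hα h.2), abs_zero]) (fun h => absurd (Finset.mem_univ κ) h)]
    exact Finset.sum_congr rfl fun β _ => by rw [jetR_apply, if_pos ⟨hp, rfl⟩]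
  · rw [if_neg hp, zero_mul]
    exact Finset.sum_eq_zero fun α _ => Finset.sum_eq_zero fun β _ => by rw [jetR_apply, if_neg (fun h => hp h.1), abs_zero]

/-- [folklore] **FIBRE SUM OF `jetC`**: `Σ_{αβ} |jetC κ u Y p q α β| = [q = u]·Σ_α |Y(p+e_α, u+e_κ) − Y(p, u+e_κ)|` (one pinned column). -/
theorem sum_abs_jetC (Y : MKer 4 Unit) (p q : Site 4) :
    ∑ α, ∑ β, |jetC κ u Y p q α β|
      = (if q = u then (1 : ℝ) else 0) * ∑ α, |Y (p + unitVec α) (u + unitVec κ) () () - Y p (u + unitVec κ) () ()| := by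
  by_cases hq : q = u
  · rw [if_pos hq, one_mul]
    refine Finset.sum_congr rfl fun α _ => ?_
    rw [Finset.sum_eq_single κ (fun β _ hβ => by rw [jetC_apply, if_neg (fun h => hβ h.2), abs_zero])
      (fun h => absurd (Finset.mem_univ κ) h), jetC_apply, if_pos ⟨hq, rfl⟩]
  · rw [if_neg hq, zero_mul]
    exact Finset.sum_eq_zero fun α _ => Finset.sum_eq_zero fun β _ => by rw [jetC_apply, if_neg (fun h => hq h.1), abs_zero]

end Summit.QuantumFields.BalabanUV.Beta.D1BFx.CoframeJetDipole

end
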